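import Mathlib.Analysis.Calculus.BumpFunction.Basic
import Mathlib.Analysis.Calculus.BumpFunction.InnerProduct
import Mathlib.Analysis.Calculus.ContDiff.Bounds
import Literature.Analysis.FunctionSpaces.TorusPeriodization
import HarnessLib

/-!
# Periodic localisation: a smooth `ℤᵈ`-periodic field equal to a given field near the lattice
# points and to a constant elsewhere (theorems only)

Analysis/FunctionSpaces support file (everything proved; no definitions, no named facts), sequel
of `TorusPeriodization.lean` (`perSum g = ∑_{k ∈ ℤᵈ} g(· + k)`). Given a smooth field `f` on
`ℝᵈ`, a constant state `c` and a bump `χ` (`= 1` on `|y| ≤ r_in`, supported in `|y| < r_out`,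
`r_out < 1/2`), the field

  `x ↦ c + perSum (χ • (f − c)) x = c + ∑ₖ χ(x − k) (f(x − k) − c)`

is smooth and lattice periodic (`contDiff_localize`, `isLatticePeriodic_localize`), equals
`f(· − k)` on `|x − k| ≤ r_in` and `c` at distance `≥ r_out` from the lattice
(`localize_eq_of_norm_sub_le`, `localize_eq_const`), takes values between those of `f` and `c`
(`le_localize`, `localize_le`: e.g. positivity of a localised density), and — the point of the
file — ALL its derivatives are bounded by those of `f − c` on the ball `|y| ≤ r_out` with constants
depending only on `χ` and the order (`norm_iteratedFDeriv_localize_le`). This is the standard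
construction of periodic initial data that coincide with prescribed (e.g. self-similar) data
near one point of the period cell and with a constant state away from it, used to transfer a
blow-up construction from `ℝ³` to `𝕋³` by finite speed of propagation
([cite: CaolaboraEtAl2025, Rem. 1.5 p. 7]: "the singularity for the periodic setting follows from
[the Euclidean one] and the finite speed of propagation"); the derivative bounds make the size
of the data in any `Cᵏ`/`Hᵏ` norm uniform over a family of prescribed fields that is bounded in
`Cᵏ(|y| ≤ r_out)`. [folklore]
-/

noncomputable section

open Set Function Filter Topology Metric
open scoped ContDiff

namespace Literature.Analysis.FunctionSpaces

namespace Torus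

variable {d : Type*} [Fintype d] [DecidableEq d]
variable {F : Type*} [NormedAddCommGroup F] [NormedSpace ℝ F]

/-! ### Lattice geometry -/

/-- A non-zero lattice vector has norm at least `1`. [folklore] -/
theorem one_le_norm_latticeVec {k : d → ℤ} (hk : k ≠ 0) : 1 ≤ ‖latticeVec k‖ := by
  obtain ⟨i, hi⟩ : ∃ i, k i ≠ 0 := by
    by_contra h
    push Not at h
    exact hk (funext h)
  have h1 : (1 : ℝ) ≤ |(k i : ℝ)| := by
    rw [← Int.cast_abs]
    exact_mod_cast Int.one_le_abs hi
  exact h1.trans (abs_le_norm_latticeVec k i)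

omit [NormedSpace ℝ F] in
/-- **Single-term evaluation of the periodisation.** If `h` is supported in `|y| ≤ b` and
`|x − k| < 1 − b`, only the translate by `−k` contributes: `perSum h x = h (x − k)`. [folklore] -/
theorem perSum_eq_of_norm_sub_lt {h : EuclideanSpace ℝ d → F} {b : ℝ}
    (hb : support h ⊆ closedBall 0 b) (k : d → ℤ) {x : EuclideanSpace ℝ d}
    (hx : ‖x - latticeVec k‖ < 1 - b) : perSum h x = h (x - latticeVec k) := by
  rw [perSum_apply, tsum_eq_single (-k)]
  · rw [latticeVec_neg, ← sub_eq_add_neg]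
  · intro m hm
    by_contra hne
    have h1 : ‖x + latticeVec m‖ ≤ b := by simpa using hb (mem_support.2 hne)
    have h2 : m + k ≠ 0 := fun h0 => hm (eq_neg_of_add_eq_zero_left h0)
    have h3 : 1 ≤ ‖latticeVec (m + k)‖ := one_le_norm_latticeVec h2
    have h4 : latticeVec (m + k) = (x + latticeVec m) - (x - latticeVec k) := by
      rw [latticeVec_add]; abel
    have h5 : ‖latticeVec (m + k)‖ ≤ ‖x + latticeVec m‖ + ‖x - latticeVec k‖ := by
      rw [h4]; exact norm_sub_le _ _
    linarith

omit [NormedSpace ℝ F] in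
/-- If every lattice translate of `x` is outside the support ball, the periodisation vanishes at
`x`. [folklore] -/
theorem perSum_eq_zero_of_forall {h : EuclideanSpace ℝ d → F} {b : ℝ}
    (hb : support h ⊆ ball 0 b) {x : EuclideanSpace ℝ d} (hx : ∀ k : d → ℤ, b ≤ ‖x - latticeVec k‖) :
    perSum h x = 0 := by
  rw [perSum_apply]
  have h0 : (fun m : d → ℤ => h (x + latticeVec m)) = fun _ => 0 := by
    funext m
    by_contra hne
    have h1 : ‖x + latticeVec m‖ < b := by simpa using hb (mem_support.2 hne)
    have h2 := hx (-m)
    rw [latticeVec_neg, sub_neg_eq_add] at h2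
    linarith
  rw [h0, tsum_zero]

/-! ### The localised field -/

section Localize

variable (χ : ContDiffBump (0 : EuclideanSpace ℝ d)) (f : EuclideanSpace ℝ d → F) (c : F)

omit [DecidableEq d] in
/-- Support of the localised perturbation `χ • (f − c)`. [folklore] -/
theorem support_bump_smul_subset :
    support (fun y => χ y • (f y - c)) ⊆ ball 0 χ.rOut := by
  intro y hy
  rw [mem_support] at hy
  have : χ y ≠ 0 := fun h0 => hy (by rw [h0, zero_smul])
  rw [← χ.support_eq]
  exact mem_support.2 this

omit [DecidableEq d] in
/-- Topological support of the localised perturbation. [folklore] -/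
theorem tsupport_bump_smul_subset :
    tsupport (fun y => χ y • (f y - c)) ⊆ closedBall 0 χ.rOut :=
  (tsupport_smul_subset_left _ _).trans (by rw [χ.tsupport_eq])

variable {χ f}

/-- **Smoothness** of the localised periodic field. [folklore] -/
theorem contDiff_localize {n : ℕ∞} (hf : ContDiff ℝ n f) :
    ContDiff ℝ n fun x => c + perSum (fun y => χ y • (f y - c)) x :=
  contDiff_const.add (contDiff_perSum ((χ.contDiff (n := n)).smul (hf.sub contDiff_const))
    (tsupport_bump_smul_subset χ f c))

variable (χ f)

/-- **Periodicity** of the localised field. [folklore] -/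
theorem isLatticePeriodic_localize :
    IsLatticePeriodic fun x => c + perSum (fun y => χ y • (f y - c)) x := by
  intro j x
  simp only [isLatticePeriodic_perSum _ j x]

variable {χ}

/-- **Local formula**: near the lattice point `k` (`|x − k| < 1 − r_out`) the localised field is
`c + χ(x − k)(f(x − k) − c)`. [folklore] -/
theorem localize_eq_of_norm_sub_lt (k : d → ℤ) {x : EuclideanSpace ℝ d}
    (hx : ‖x - latticeVec k‖ < 1 - χ.rOut) :
    c + perSum (fun y => χ y • (f y - c)) x =
      c + χ (x - latticeVec k) • (f (x - latticeVec k) - c) := by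
  rw [perSum_eq_of_norm_sub_lt ((support_bump_smul_subset χ f c).trans ball_subset_closedBall) k hx]

/-- The localised field **equals `f(· − k)`** on `|x − k| ≤ r_in`. [folklore] -/
theorem localize_eq_of_norm_sub_le (hχ : χ.rOut ≤ 1 / 2) (k : d → ℤ) {x : EuclideanSpace ℝ d}
    (hx : ‖x - latticeVec k‖ ≤ χ.rIn) :
    c + perSum (fun y => χ y • (f y - c)) x = f (x - latticeVec k) := by
  have h1 : ‖x - latticeVec k‖ < 1 - χ.rOut := by linarith [χ.rIn_lt_rOut]
  rw [localize_eq_of_norm_sub_lt f c k h1,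
    χ.one_of_mem_closedBall (by simpa using hx), one_smul, add_sub_cancel]

/-- The localised field **equals the constant `c`** at distance `≥ r_out` from the lattice.
[folklore] -/
theorem localize_eq_const {x : EuclideanSpace ℝ d} (hx : ∀ k : d → ℤ, χ.rOut ≤ ‖x - latticeVec k‖) :
    c + perSum (fun y => χ y • (f y - c)) x = c := by
  rw [perSum_eq_zero_of_forall (support_bump_smul_subset χ f c) hx, add_zero]

/-- **Everywhere a single translate, locally**: with `r_out < 1/2`, around every point `x` there
is one lattice point `k` such that the periodisation of `χ • (f − c)` equals its `k`-translate
on the ball of radius `1/2 − r_out` about `x` (if no lattice point is within `1/2` of `x`, both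
vanish there; meaningful for `r_out < 1/2`). [folklore] -/
theorem exists_perSum_eqOn_ball (x : EuclideanSpace ℝ d) :
    ∃ k : d → ℤ, ∀ y ∈ ball x (1 / 2 - χ.rOut),
      perSum (fun y => χ y • (f y - c)) y = χ (y - latticeVec k) • (f (y - latticeVec k) - c) := by
  by_cases hk : ∃ k : d → ℤ, ‖x - latticeVec k‖ < 1 / 2
  · obtain ⟨k, hk⟩ := hk
    refine ⟨k, fun y hy => ?_⟩
    rw [mem_ball, dist_eq_norm] at hy
    refine perSum_eq_of_norm_sub_lt
      ((support_bump_smul_subset χ f c).trans ball_subset_closedBall) k ?_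
    calc ‖y - latticeVec k‖ ≤ ‖y - x‖ + ‖x - latticeVec k‖ := norm_sub_le_norm_sub_add_norm_sub _ _ _
      _ < 1 - χ.rOut := by linarith
  · push Not at hk
    refine ⟨0, fun y hy => ?_⟩
    rw [mem_ball, dist_eq_norm] at hy
    have hfar : ∀ m : d → ℤ, χ.rOut ≤ ‖y - latticeVec m‖ := by
      intro m
      have h1 := hk m
      have h2 : ‖x - latticeVec m‖ ≤ ‖x - y‖ + ‖y - latticeVec m‖ :=
        norm_sub_le_norm_sub_add_norm_sub _ _ _
      rw [norm_sub_rev x y] at h2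
      linarith
    rw [perSum_eq_zero_of_forall (support_bump_smul_subset χ f c) hfar]
    have h0 : χ (y - latticeVec 0) = 0 := by
      refine χ.zero_of_le_dist ?_
      rw [dist_zero_right]
      exact hfar 0
    rw [h0, zero_smul]

/-- **Order**: for real fields, if `m ≤ f` and `m ≤ c` then `m ≤` the localised field (convex
combination `(1 − χ)c + χ f` near the lattice, `c` elsewhere); e.g. positivity of a localised
density. [folklore] -/
theorem le_localize {f : EuclideanSpace ℝ d → ℝ} {c m : ℝ} (hχ : χ.rOut < 1 / 2)
    (hf : ∀ y, m ≤ f y) (hc : m ≤ c) (x : EuclideanSpace ℝ d) :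
    m ≤ c + perSum (fun y => χ y • (f y - c)) x := by
  obtain ⟨k, hk⟩ := exists_perSum_eqOn_ball f c x
  rw [hk x (mem_ball_self (by linarith)), smul_eq_mul]
  have h0 := χ.nonneg' (x - latticeVec k)
  have h1 := χ.le_one (x := x - latticeVec k)
  nlinarith [hf (x - latticeVec k)]

/-- **Order**, upper version: if `f ≤ M` and `c ≤ M` then the localised field is `≤ M`.
[folklore] -/
theorem localize_le {f : EuclideanSpace ℝ d → ℝ} {c M : ℝ} (hχ : χ.rOut < 1 / 2)
    (hf : ∀ y, f y ≤ M) (hc : c ≤ M) (x : EuclideanSpace ℝ d) :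
    c + perSum (fun y => χ y • (f y - c)) x ≤ M := by
  obtain ⟨k, hk⟩ := exists_perSum_eqOn_ball f c x
  rw [hk x (mem_ball_self (by linarith)), smul_eq_mul]
  have h0 := χ.nonneg' (x - latticeVec k)
  have h1 := χ.le_one (x := x - latticeVec k)
  nlinarith [hf (x - latticeVec k)]

end Localize

/-! ### Bounds on all derivatives -/

section Bounds

omit [DecidableEq d] in
/-- Uniform bounds for the derivatives of a bump up to a given order. [folklore] -/
theorem exists_bound_iteratedFDeriv_bump (χ : ContDiffBump (0 : EuclideanSpace ℝ d)) (n : ℕ) :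
    ∃ B : ℝ, 0 ≤ B ∧ ∀ i, i ≤ n → ∀ y, ‖iteratedFDeriv ℝ i (fun y => χ y) y‖ ≤ B := by
  induction n with
  | zero =>
    refine ⟨1, zero_le_one, fun i hi y => ?_⟩
    obtain rfl : i = 0 := Nat.le_zero.1 hi
    rw [norm_iteratedFDeriv_zero, Real.norm_eq_abs, abs_of_nonneg (χ.nonneg' y)]
    exact χ.le_one
  | succ n ih =>
    obtain ⟨B, hB0, hB⟩ := ih
    obtain ⟨C, hC⟩ := (χ.hasCompactSupport.iteratedFDeriv (𝕜 := ℝ) (n + 1)).exists_bound_of_continuous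
      (χ.contDiff.continuous_iteratedFDeriv' (m := n + 1))
    refine ⟨max B C, le_max_of_le_left hB0, fun i hi y => ?_⟩
    rcases Nat.lt_or_eq_of_le hi with h | rfl
    · exact (hB i (Nat.lt_succ_iff.1 h) y).trans (le_max_left _ _)
    · exact (hC y).trans (le_max_right _ _)

omit [DecidableEq d] in
/-- **Leibniz bound for the localised perturbation**: if `‖∇ʲ(f − c)‖ ≤ A` on `|y| ≤ r_out` for
`j ≤ n`, then `‖∇ⁿ(χ • (f − c))(y)‖ ≤ 2ⁿ B_χ A` everywhere (`B_χ` bounds the derivatives of `χ` up to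
order `n`; outside the ball the perturbation vanishes identically). [folklore] -/
theorem norm_iteratedFDeriv_bump_smul_le (χ : ContDiffBump (0 : EuclideanSpace ℝ d)) {n : ℕ}
    {B : ℝ} (hB0 : 0 ≤ B) (hB : ∀ i, i ≤ n → ∀ y, ‖iteratedFDeriv ℝ i (fun y => χ y) y‖ ≤ B)
    {f : EuclideanSpace ℝ d → F} (hf : ContDiff ℝ ∞ f) {c : F} {A : ℝ}
    (hA : ∀ j, j ≤ n → ∀ y, ‖y‖ ≤ χ.rOut → ‖iteratedFDeriv ℝ j (fun y => f y - c) y‖ ≤ A)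
    (y : EuclideanSpace ℝ d) :
    ‖iteratedFDeriv ℝ n (fun y => χ y • (f y - c)) y‖ ≤ 2 ^ n * B * A := by
  have hA0 : 0 ≤ A := le_trans (norm_nonneg _) (hA 0 (Nat.zero_le _) 0 (by simpa using χ.rOut_pos.le))
  by_cases hy : ‖y‖ ≤ χ.rOut
  · have hfc : ContDiff ℝ ∞ fun y => f y - c := hf.sub contDiff_const
    have hχs : ContDiff ℝ ∞ fun y => χ y := χ.contDiff
    have h := norm_iteratedFDeriv_smul_le (𝕜 := ℝ) hχs hfc y (n := n) (by exact_mod_cast le_top)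
    refine h.trans ?_
    calc ∑ i ∈ Finset.range (n + 1), (n.choose i : ℝ) * ‖iteratedFDeriv ℝ i (fun y => χ y) y‖ *
          ‖iteratedFDeriv ℝ (n - i) (fun y => f y - c) y‖
        ≤ ∑ i ∈ Finset.range (n + 1), (n.choose i : ℝ) * B * A := by
          refine Finset.sum_le_sum fun i hi => ?_
          have hin : i ≤ n := Nat.lt_succ_iff.1 (Finset.mem_range.1 hi)
          have h1 := hB i hin y
          have h2 := hA (n - i) (Nat.sub_le n i) y hy
          have h3 : ‖iteratedFDeriv ℝ i (fun y => χ y) y‖ * ‖iteratedFDeriv ℝ (n - i) (fun y => f y - c) y‖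
              ≤ B * A := mul_le_mul h1 h2 (norm_nonneg _) hB0
          calc (n.choose i : ℝ) * ‖iteratedFDeriv ℝ i (fun y => χ y) y‖ *
                ‖iteratedFDeriv ℝ (n - i) (fun y => f y - c) y‖
              = (n.choose i : ℝ) * (‖iteratedFDeriv ℝ i (fun y => χ y) y‖ *
                  ‖iteratedFDeriv ℝ (n - i) (fun y => f y - c) y‖) := by ring
            _ ≤ (n.choose i : ℝ) * (B * A) := mul_le_mul_of_nonneg_left h3 (Nat.cast_nonneg _)
            _ = (n.choose i : ℝ) * B * A := by ring
      _ = 2 ^ n * B * A := by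
          rw [← Finset.sum_mul, ← Finset.sum_mul]
          congr 2
          have h := Nat.sum_range_choose n
          exact_mod_cast h
  · -- outside the ball the perturbation vanishes near `y`
    push Not at hy
    have h0 : iteratedFDeriv ℝ n (fun y => χ y • (f y - c)) y = 0 := by
      apply notMem_support.1
      intro hmem
      have h1 := support_iteratedFDeriv_subset n hmem
      have h2 := tsupport_bump_smul_subset χ f c h1
      rw [mem_closedBall, dist_zero_right] at h2
      linarith
    rw [h0, norm_zero]
    positivity

/-- **All derivatives of the localised periodic field are controlled by those of `f − c` on the
ball `|y| ≤ r_out`**, with a constant depending only on the bump and the order: for `r_out < 1/2`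
and every `n` there is `K` such that `‖∇ʲ(f − c)‖ ≤ A` on `|y| ≤ r_out` for all `j ≤ n` implies
`‖∇ⁿ perSum(χ • (f − c))(x)‖ ≤ K A` for all `x`. [folklore] -/
theorem norm_iteratedFDeriv_localize_le (χ : ContDiffBump (0 : EuclideanSpace ℝ d))
    (hχ : χ.rOut < 1 / 2) (n : ℕ) :
    ∃ K : ℝ, 0 ≤ K ∧ ∀ ⦃f : EuclideanSpace ℝ d → F⦄, ContDiff ℝ ∞ f → ∀ (c : F) ⦃A : ℝ⦄,
      (∀ j, j ≤ n → ∀ y, ‖y‖ ≤ χ.rOut → ‖iteratedFDeriv ℝ j (fun y => f y - c) y‖ ≤ A) →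
      ∀ x, ‖iteratedFDeriv ℝ n (perSum fun y => χ y • (f y - c)) x‖ ≤ K * A := by
  obtain ⟨B, hB0, hB⟩ := exists_bound_iteratedFDeriv_bump χ n
  refine ⟨2 ^ n * B, by positivity, fun f hf c A hA x => ?_⟩
  obtain ⟨k, hk⟩ := exists_perSum_eqOn_ball f c x
  have hev : (perSum fun y => χ y • (f y - c)) =ᶠ[𝓝 x]
      fun y => χ (y - latticeVec k) • (f (y - latticeVec k) - c) :=
    Filter.eventuallyEq_of_mem (ball_mem_nhds x (by linarith)) hk
  rw [(hev.iteratedFDeriv ℝ n).eq_of_nhds]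
  have hshift : iteratedFDeriv ℝ n (fun y => χ (y - latticeVec k) • (f (y - latticeVec k) - c)) x =
      iteratedFDeriv ℝ n (fun y => χ y • (f y - c)) (x - latticeVec k) :=
    iteratedFDeriv_comp_sub (f := fun y => χ y • (f y - c)) n (latticeVec k) x
  rw [hshift]
  exact norm_iteratedFDeriv_bump_smul_le χ hB0 hB hf hA _

end Bounds

end Torus

end Literature.Analysis.FunctionSpaces
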